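import Summits.ABC.IUTFork.Cor312StatementPilotNouns
import Summits.ABC.IUTFork.Cor312StatementBridge
import Summits.ABC.IUTFork.Cor312QTwist
import Summits.ABC.IUTFork.Thm311Regions
import HarnessLib

/-!
# [IUTchIII] Cor. 3.12 — the componentwise admissibility `PilotNouns.ComponentAdm` of the proof-chain apex
# HOLDS at the nouns of a `Cor312.Setting` under abc-iut-c312-6's bridge hypotheses

PROOF-ONLY support file of the abc-iut cell (wave-5 prover seat abc-iut-w5-d235, gen 2; Cor. 3.12 cone, D-0067
kernel-DAG bookkeeping). TAKES NO SIDE on [IUTchIII] Cor. 3.12; no `def`, no `Prop` fact.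

abc-iut-c312-1's `Thm311.PilotNouns.ComponentAdm n m j v_ℚ` (`Thm311Regions.lean`; the admissibility data the
skeleton's `ForkRegions.Cor312Setting` requires of one component: monotone `μ^log` on admissible regions, every
possible image admissible, the hull `^{n,∘}𝒰_{j,v_ℚ}` admissible, the `q`-pilot region admissible — [IUTchIII]
Prop. 3.9 (i)/(ii), Rmk. 3.9.5 (i), Cor. 3.12 p. 174 l. 16 "`−|log(Θ)| ∈ ℝ`") is a HYPOTHESIS of abc-iut-c312-2's
M-apex `DAG.summit_of_cor312_M` (`hadm : ∀ P j v_ℚ, (Pn P).ComponentAdm n m j v_ℚ`) and of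
`Cor312EdgeAggregate.cor312At_of_qCongruentSubHullAgg`; the machine census of HOME/plan/C312-RESIDUALS.md §3 lists it
with NO producer. abc-iut-c312-7's dictionary `Cor312.Setting.toPilotNouns` (`Cor312StatementPilotNouns.lean`,
p406563) instantiates the nouns from a `Cor312.Setting`; THIS FILE proves that at those nouns, at the setting's own
line `n := P.n` and every column `m`, `ComponentAdm` FOLLOWS from abc-iut-c312-6's `Cor312Vol.BridgeHyps P`
(`Cor312StatementBridge.lean`) — field by field: `mono` ← `LogvolMono`; `U_adm` ← `image_adm`; `Uhol_adm` ←
`finite` (`ThetaFinite` ⇒ `HullDefined` ⇒ the hull is a hull-set, `Setting.thetaHull_adm`); `Q_adm` ← the setting's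
own `qRegion_mem`/`hul_adm` (no bridge hypothesis needed: `Setting.qRegion_adm` of `Cor312QTwist.lean`, p412212). Consequently every landed `BridgeHyps`
witness (toy, naive, pinned p418585, and the assembled real DH setting's `Real.bridgeHyps_settingDHVol` chain of
abc-iut-c312-5 once its `finite` field is closed) IS a `ComponentAdm` witness for the corresponding nouns, and the
apex hypothesis `hadm` at `Pn := (setting).toPilotNouns`, `n := setting.n` reduces BY NAME to `BridgeHyps`.
Bookkeeping over landed declarations only. [claim: Mochizuki2012, status: disputed] for the quoted nouns;
typed ≠ proved; instantiated ≠ endorsed.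
-/

noncomputable section

namespace Summit.ABC.IUTFork.Cor312.Setting

open Thm311 Cor312Vol Literature.IUT.LogThetaLattice

variable {T : ThetaIndex} {S : LatticeSituation T} (P : Setting S.toSituation)

/-- A nonzero label `j ∈ 𝔽_l^⋇` is `labelSucc` of its enumerating index (`succEquiv`). [folklore] -/
theorem labelStar_eq_labelSucc (j : T.LabelStar) : j.1 = labelSucc ((succEquiv T).symm j) :=
  (labelSucc_symm j).symm

variable {P}

/-- **`ComponentAdm` at the nouns of a setting, from the bridge hypotheses.** For a `Cor312.Setting P` satisfying
abc-iut-c312-6's `BridgeHyps`, c312-1's componentwise admissibility holds for `P.toPilotNouns` at the setting's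
line `P.n`, for every column `m`, every `j ∈ 𝔽_l^⋇` and every `v_ℚ`: monotonicity ← `LogvolMono`; possible images
admissible ← `image_adm`; `^{n,∘}𝒰_{j,v_ℚ}` admissible ← `ThetaFinite` (through `HullDefined`, `thetaHull_adm`);
`q`-region admissible ← `qRegion_adm`. [claim: Mochizuki2012, status: disputed] -/
theorem componentAdm_toPilotNouns_of_bridgeHyps (H : BridgeHyps P) (m : ℤ) (j : T.LabelStar) (vQ : T.VQ) :
    P.toPilotNouns.ComponentAdm P.n m j vQ := by
  obtain ⟨j, hj⟩ := j
  -- rewrite the label as `labelSucc i`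
  obtain ⟨i, rfl⟩ : ∃ i : Fin T.lstar, labelSucc i = j :=
    ⟨(succEquiv T).symm ⟨j, hj⟩, labelSucc_symm ⟨j, hj⟩⟩
  refine ⟨?_, ?_, ?_, ?_⟩
  · intro A B hA hB hAB
    exact H.mono i vQ hA hB hAB
  · intro R hR
    exact H.image_adm i vQ R hR
  · show (S.D P.n).Adm _ vQ (P.thetaHull (labelSucc i) vQ)
    exact P.thetaHull_adm (P.hullDefined_of_thetaFinite H.finite i vQ)
  · exact P.qRegion_adm _ vQ

/-- The same, quantified as the apex consumes it (`∀ j v_ℚ`). [claim: Mochizuki2012, status: disputed] -/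
theorem componentAdm_toPilotNouns_of_bridgeHyps' (H : BridgeHyps P) (m : ℤ) :
    ∀ (j : T.LabelStar) (vQ : T.VQ), P.toPilotNouns.ComponentAdm P.n m j vQ :=
  fun j vQ => componentAdm_toPilotNouns_of_bridgeHyps H m j vQ

/-- Conversely-shaped bookkeeping: componentwise admissibility at every nonzero label GIVES BACK the two
admissibility fields of `BridgeHyps` that concern single packets (`mono`, `image_adm`) — so on these two fields the
apex hypothesis `hadm` and the bridge hypotheses carry the same information; `BridgeHyps` additionally asks for
finite support along global image choices, nonemptiness, and `ThetaFinite`. [folklore] -/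
theorem logvolMono_and_image_adm_of_componentAdm (m : ℤ)
    (h : ∀ (j : T.LabelStar) (vQ : T.VQ), P.toPilotNouns.ComponentAdm P.n m j vQ) :
    LogvolMono P ∧
      ∀ (i : Fin T.lstar) (vQ : T.VQ), ∀ U ∈ P.possibleImages (labelSucc i) vQ, (S.D P.n).Adm _ vQ U :=
  ⟨fun i vQ _ _ hA hB hAB => (h ⟨labelSucc i, labelSucc_ne_zero i⟩ vQ).mono hA hB hAB,
    fun i vQ U hU => (h ⟨labelSucc i, labelSucc_ne_zero i⟩ vQ).U_adm U hU⟩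

/-! ## Appendix (v2): the apex's component readings ARE the adjudication's readings R1/R2/R3 at the setting

abc-iut-c312-2's M-apexes take, per component `(j, v_ℚ)`, a LICENCE on the component container
`(Pn).toCor312Setting n m j v_ℚ hadm` — skel's `Cor312Setting.QSubHull` (Reading 2: `Q ⊆ U^{hol}`), `QIsImage`
(Reading 3: `Q` IS a possible image) or `RepresentedVol` (Reading 1, LANA §8.3: the `q`-log-volume is one of the
possible values). At the nouns of a `Cor312.Setting` (`toPilotNouns`, admissibility from `BridgeHyps`) these are,
definitionally up to c312-7's dictionary, the adjudication's readings over the setting: R2 `qRegion ⊆ thetaHull`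
(input of `Cor312Vol.statement_of_qRegion_subset_thetaHull`), R3 `qRegion ∈ possibleImages` (input of
`Cor312Vol.statement_of_qRegion_mem_possibleImages`; the CONCLUSION of PR-1's `Cor312Vol.GapA''` under the pins), R1
`∃ U ∈ possibleImages, μ^log(U) = μ^log(qRegion)`. Dictionary only; no reading is asserted. -/

/-- **Reading 2 at a component = R2 at the setting**: for the nouns of a setting, skel's `QSubHull` of the component
container at `(j, v_ℚ)` is `P.qRegion j v_ℚ ⊆ P.thetaHull j v_ℚ` (c312-7's `uhol_eq`; the same unfolding as c312-1 H's
`toCor312Setting_Uhol`). [claim: Mochizuki2012, status: disputed] -/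
theorem qSubHull_toPilotNouns_iff (H : BridgeHyps P) (m : ℤ) (j : T.LabelStar) (vQ : T.VQ) :
    (P.toPilotNouns.toCor312Setting P.n m j vQ (componentAdm_toPilotNouns_of_bridgeHyps H m j vQ)).QSubHull ↔
      P.qRegion j.1 vQ ⊆ P.thetaHull j.1 vQ := by
  have hU : (P.toPilotNouns.toCor312Setting P.n m j vQ (componentAdm_toPilotNouns_of_bridgeHyps H m j vQ)).Uhol =
      P.thetaHull j.1 vQ := by
    show P.toPilotNouns.hull P.n j.1 vQ (⋃ R : P.toPilotNouns.possibleImages P.n m j vQ, R.1) = _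
    rw [← Set.sUnion_eq_iUnion]
    rfl
  unfold Cor312Setting.QSubHull
  rw [hU]
  rfl

/-- **Reading 3 at a component = R3 at the setting**: skel's `QIsImage` of the component container at `(j, v_ℚ)` is
`P.qRegion j v_ℚ ∈ P.possibleImages j v_ℚ` — the conclusion of PR-1's `GapA″` at that component.
[claim: Mochizuki2012, status: disputed] -/
theorem qIsImage_toPilotNouns_iff (H : BridgeHyps P) (m : ℤ) (j : T.LabelStar) (vQ : T.VQ) :
    (P.toPilotNouns.toCor312Setting P.n m j vQ (componentAdm_toPilotNouns_of_bridgeHyps H m j vQ)).QIsImage ↔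
      P.qRegion j.1 vQ ∈ P.possibleImages j.1 vQ := by
  constructor
  · rintro ⟨⟨R, hR⟩, hRQ⟩
    have h : R = P.qRegion j.1 vQ := hRQ
    exact h ▸ hR
  · intro h
    exact ⟨⟨P.qRegion j.1 vQ, h⟩, rfl⟩

/-- **Reading 1 at a component = R1 at the setting**: skel's `RepresentedVol` of the component container at
`(j, v_ℚ)` says some possible image of the Θ-pilot region has the `q`-pilot image's log-volume.
[claim: Mochizuki2012, status: disputed] -/
theorem representedVol_toPilotNouns_iff (H : BridgeHyps P) (m : ℤ) (j : T.LabelStar) (vQ : T.VQ) :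
    (P.toPilotNouns.toCor312Setting P.n m j vQ (componentAdm_toPilotNouns_of_bridgeHyps H m j vQ)).RepresentedVol ↔
      ∃ U ∈ P.possibleImages j.1 vQ, (S.D P.n).logvol j.1 vQ U = (S.D P.n).logvol j.1 vQ (P.qRegion j.1 vQ) := by
  constructor
  · rintro ⟨⟨R, hR⟩, hRQ⟩
    exact ⟨R, hR, hRQ⟩
  · rintro ⟨U, hU, hUQ⟩
    exact ⟨⟨U, hU⟩, hUQ⟩

/-- Hence, at the nouns of a setting with the bridge hypotheses, R3 at every component gives the apex licence
`QSubHull` at every component (a possible image lies in the hull of their union: `HullFrame.subset_hull`), i.e.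
Reading 3 ⟹ Reading 2 transported through the dictionary. [folklore] -/
theorem qSubHull_toPilotNouns_of_mem_possibleImages (H : BridgeHyps P) (m : ℤ) (j : T.LabelStar) (vQ : T.VQ)
    (h : P.qRegion j.1 vQ ∈ P.possibleImages j.1 vQ) :
    (P.toPilotNouns.toCor312Setting P.n m j vQ (componentAdm_toPilotNouns_of_bridgeHyps H m j vQ)).QSubHull := by
  rw [qSubHull_toPilotNouns_iff H]
  exact (Set.subset_sUnion_of_mem h).trans ((P.frame j.1 vQ).subset_hull _)

/-! ## Appendix (v3): the apex ROUTE through the nouns of a setting, and its contrapositive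

Forward: at the nouns of a setting with the bridge hypotheses, the apex licence at every component (Reading 2, or
Reading 1) yields c312-1's aggregate `Cor312At` and hence the printed `Statement` (c312-7's `statement_of_cor312At`).
Contrapositive: EVERY setting with `BridgeHyps` and `¬ Statement` — i.e. every (G3)-type countermodel of the
adjudication (naive, pinned p418585, capstone, real-frame reglue, …) — REFUTES the M-apex licence `hLic` (and its
Reading-1 variant) at its own nouns: at some component `(j, v_ℚ)` the `q`-pilot region is NOT inside `^{n,∘}𝒰_{j,v_ℚ}`
(resp. no possible image has the `q`-log-volume). Bookkeeping; no judgement on which settings are the intended ones. -/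

/-- **Apex route at the nouns of a setting**: `BridgeHyps` + Reading 2 at every component ⟹ the printed `Statement`
of Cor. 3.12 (c312-1 H `cor312At_of_componentwise` + c312-7 `statement_of_cor312At`; `hreal`/`hqreal` from
`negLogThetaReal`/`negLogQReal`). [claim: Mochizuki2012, status: disputed] -/
theorem statement_of_forall_qSubHull_toPilotNouns (H : BridgeHyps P) (m : ℤ)
    (hLic : ∀ (j : T.LabelStar) (vQ : T.VQ),
      (P.toPilotNouns.toCor312Setting P.n m j vQ (componentAdm_toPilotNouns_of_bridgeHyps H m j vQ)).QSubHull) :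
    P.Statement :=
  P.statement_of_cor312At H.finite
    (P.toPilotNouns.cor312At_of_componentwise P.n m (componentAdm_toPilotNouns_of_bridgeHyps' H m)
      (P.negLogThetaReal H.finite m) (P.negLogQReal m)
      fun j vQ => Cor312Setting.cor312_of_qSubHull _ (hLic j vQ))

/-- The same with Reading 1 (`RepresentedVol`) at every component. [claim: Mochizuki2012, status: disputed] -/
theorem statement_of_forall_representedVol_toPilotNouns (H : BridgeHyps P) (m : ℤ)
    (hLic : ∀ (j : T.LabelStar) (vQ : T.VQ),
      (P.toPilotNouns.toCor312Setting P.n m j vQ (componentAdm_toPilotNouns_of_bridgeHyps H m j vQ)).RepresentedVol) :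
    P.Statement :=
  P.statement_of_cor312At H.finite
    (P.toPilotNouns.cor312At_of_componentwise P.n m (componentAdm_toPilotNouns_of_bridgeHyps' H m)
      (P.negLogThetaReal H.finite m) (P.negLogQReal m)
      fun j vQ => Cor312Setting.cor312_of_representedVol _ (hLic j vQ))

/-- Reading 3 at every component (as a statement over the setting: `qRegion ∈ possibleImages` at every nonzero label)
⟹ the printed `Statement`. [claim: Mochizuki2012, status: disputed] -/
theorem statement_of_forall_mem_possibleImages (H : BridgeHyps P)
    (h : ∀ (j : T.LabelStar) (vQ : T.VQ), P.qRegion j.1 vQ ∈ P.possibleImages j.1 vQ) : P.Statement :=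
  statement_of_forall_qSubHull_toPilotNouns H 0 fun j vQ => qSubHull_toPilotNouns_of_mem_possibleImages H 0 j vQ (h j vQ)

/-- **Contrapositive — every (G3)-type countermodel refutes the apex licence at its own nouns**: a setting with
`BridgeHyps` whose printed `Statement` FAILS has a component `(j, v_ℚ)`, `j ∈ 𝔽_l^⋇`, at which Reading 2 fails
(`q`-region ⊄ `^{n,∘}𝒰_{j,v_ℚ}`), for every column `m`. [folklore] -/
theorem exists_not_qSubHull_toPilotNouns_of_not_statement (H : BridgeHyps P) (hns : ¬ P.Statement) (m : ℤ) :
    ∃ (j : T.LabelStar) (vQ : T.VQ),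
      ¬ (P.toPilotNouns.toCor312Setting P.n m j vQ (componentAdm_toPilotNouns_of_bridgeHyps H m j vQ)).QSubHull := by
  by_contra h
  push Not at h
  exact hns (statement_of_forall_qSubHull_toPilotNouns H m h)

/-- … equivalently, at some component the `q`-pilot region is not contained in the hull of the possible images
(R2 fails there) … [folklore] -/
theorem exists_not_qRegion_subset_thetaHull_of_not_statement (H : BridgeHyps P) (hns : ¬ P.Statement) :
    ∃ (j : T.LabelStar) (vQ : T.VQ), ¬ (P.qRegion j.1 vQ ⊆ P.thetaHull j.1 vQ) := by
  obtain ⟨j, vQ, h⟩ := exists_not_qSubHull_toPilotNouns_of_not_statement H hns 0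
  exact ⟨j, vQ, fun h' => h ((qSubHull_toPilotNouns_iff H 0 j vQ).2 h')⟩

/-- … and a fortiori R3 fails there (the `q`-pilot region is not a possible image), and Reading 1 fails at some
component. [folklore] -/
theorem exists_not_mem_possibleImages_of_not_statement (H : BridgeHyps P) (hns : ¬ P.Statement) :
    ∃ (j : T.LabelStar) (vQ : T.VQ), P.qRegion j.1 vQ ∉ P.possibleImages j.1 vQ := by
  by_contra h
  push Not at h
  exact hns (statement_of_forall_mem_possibleImages H h)

/-- Reading 1 fails at some component of every such countermodel. [folklore] -/
theorem exists_not_representedVol_toPilotNouns_of_not_statement (H : BridgeHyps P) (hns : ¬ P.Statement) (m : ℤ) :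
    ∃ (j : T.LabelStar) (vQ : T.VQ),
      ¬ (P.toPilotNouns.toCor312Setting P.n m j vQ (componentAdm_toPilotNouns_of_bridgeHyps H m j vQ)).RepresentedVol := by
  by_contra h
  push Not at h
  exact hns (statement_of_forall_representedVol_toPilotNouns H m h)

end Summit.ABC.IUTFork.Cor312.Setting

end
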